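import Summits.CriticalPhenomena.SAWScalingLimit.Theorems.SAWCircleScreeningScreeningRecursionStepMarkov
import Summits.CriticalPhenomena.SAWScalingLimit.Theorems.SAWCircleScreeningScreeningRecursionStepScreen
import Summits.CriticalPhenomena.SAWScalingLimit.Theorems.SAWCircleScreeningScreeningRecursionScreensWalk
import Summits.CriticalPhenomena.SAWScalingLimit.Theorems.SAWCircleScreeningScreeningRecursionTVStep
import HarnessLib

/-!
# Screening recursion for `SAWCircleScreening`, part XVI: the one-scale coupling step for the SAW

Route `SAWCircleScreening` of `CriticalPhenomena/SAWScalingLimit`, support item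
`ScreeningRecursion` (stmt-CriticalPhenomena-5468). This file instantiates the abstract coupling
step (`Abstract.abstract_step`, part IIb) with the critical SAW of `(Ω₀ ∖ K)_δ`:

* true screen `s x` = the canonical screen datum of the support (part XI), proxy screen
  `sc x` = the datum read on the prefix up to the first exit of `B(c, Mρ)`; they agree off the
  deep-return event, whose mass is `≤ η` by the crux `NoDeepReturn` (S3);
* exact screen (`screen_identity`, part XV) with a kernel independent of the near data; overlap
  of the true screens `≥ c₁` by the crux `ScreenOverlap` (S2);
* Markov kernels (`markov_identity`, part XIV): critical SAWs of class `(M+1)ρ`, pairwise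
  `d`-close by the induction hypothesis.

**Theorem** (`one_step`). If all pairs of class-`(M+1)ρ` configurations have `Φ`-laws within `d`
(one-sided, on all sets), then all pairs of class-`ρ` configurations have `Φ`-laws within
`4η + (1 - c₁ + 4η) d`. Here a configuration `(K, a)` of class `r` is near data `K ⊆ B̄(c, r)`
and a start `a` within `r` of `c` joined to the target `b` in `(Ω₀ ∖ K)_δ`, and `Φ` is any
observable of the support forgetting initial segments inside `B(c, R⋆)`, `R⋆ ≥ Mρ + δ`.
Folklore (Garban–Pete–Schramm 2013, §3, proof of Prop. 11, transposed).
-/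

noncomputable section

open Set Metric MeasureTheory Finset
open scoped ENNReal
open Literature.Probability.LatticeModels
open Literature.Probability.RandomPlanarGeometry
open Literature.Probability.RandomPlanarGeometry.SAW

namespace Summit.CriticalPhenomena.SAWScalingLimit.Theorems.ScreeningRecursion

variable {δ : ℝ} {c : ℂ}

/-- Two options with the same `some`-values are equal. [folklore] -/
theorem Option.eq_of_forall_eq_some_iff {α : Type*} {o o' : Option α}
    (h : ∀ v, o = some v ↔ o' = some v) : o = o' := by
  cases o with
  | none =>
    cases o' with
    | none => rfl
    | some v => exact ((h v).2 rfl)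
  | some v => exact ((h v).1 rfl).symm ▸ rfl

/-- `(law {γ | P γ}).toReal` as a filtered sum of point masses. [folklore] -/
theorem toReal_law_setOf_eq_sum_filter {Ω : Set ℂ} {a b : Site 2} [Fintype (DomainSAW Ω δ a b)]
    (P : DomainSAW Ω δ a b → Prop) [DecidablePred P] :
    (law Ω δ a b {γ | P γ}).toReal = ∑ γ ∈ Finset.univ.filter P, (law Ω δ a b {γ}).toReal := by
  rw [toReal_law_eq_sum, Finset.sum_filter]
  refine Finset.sum_congr rfl fun γ _ => ?_
  by_cases h : P γ
  · simp only [mem_setOf_eq, h, if_true, mul_one]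
  · simp only [mem_setOf_eq, h, if_false, mul_zero]

section OneStep

local notation3 "ScrEv[" δ ", " c ", " ρ "](" j ", " x ", " y " ; " l ")" =>
  (2 * ρ + (j : ℝ) * δ ≤ 3 * ρ ∧
    (∃ k : ℕ, (∀ i : ℕ, (hi : i < List.length l) →
        (dist (meshPoint δ (l[i])) c < 2 * ρ + (j : ℝ) * δ ↔ i ≤ k)) ∧
      l[k]? = some x ∧ l[k + 1]? = some y) ∧
    ∀ j' : ℕ, j' < j → ¬ ∃ k : ℕ, ∀ i : ℕ, (hi : i < List.length l) →
        (dist (meshPoint δ (l[i])) c < 2 * ρ + (j' : ℝ) * δ ↔ i ≤ k))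

/-- **Route event ↔ support event.** For a SAW to a target `b` at distance `≥ 3ρ + δ` from
`c`, the route's canonical-screen event of datum `(j, x, y)` (phrased with `getVert`) is the
support-level event. [folklore] -/
theorem routeScreen_iff {Ω : Set ℂ} {ρ : ℝ} {a b : Site 2} (hbfar : 3 * ρ + δ ≤ dist (meshPoint δ b) c)
    (hδ : 0 ≤ δ) (γ : DomainSAW Ω δ a b) (p : ℕ × Site 2 × Site 2) :
    (2 * ρ + p.1 * δ ≤ 3 * ρ ∧ (∃ k : ℕ, (∀ i ≤ γ.walk.length,
        dist (meshPoint δ (γ.walk.getVert i)) c < 2 * ρ + p.1 * δ ↔ i ≤ k) ∧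
        γ.walk.getVert k = p.2.1 ∧ γ.walk.getVert (k + 1) = p.2.2) ∧
      ∀ j < p.1, ¬ ∃ k : ℕ, ∀ i ≤ γ.walk.length,
        dist (meshPoint δ (γ.walk.getVert i)) c < 2 * ρ + j * δ ↔ i ≤ k) ↔
    ScrEv[δ, c, ρ](p.1, p.2.1, p.2.2 ; γ.walk.support) := by
  by_cases h3 : 2 * ρ + (p.1 : ℝ) * δ ≤ 3 * ρ
  · have hb : 2 * ρ + (p.1 : ℝ) * δ ≤ dist (meshPoint δ b) c := by linarith
    rw [screenClause_walk_iff γ.walk _ hb]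
    simp only [sc_walk_iff]
  · constructor
    · rintro ⟨h, -⟩; exact absurd h h3
    · rintro ⟨h, -⟩; exact absurd h h3

/-- **The one-scale coupling step for the critical SAW.** See the module docstring. [folklore] -/
theorem one_step {Ω₀ : Set ℂ} {u : ℂ} {ρ₀ ρ M Rstar η d c₁ : ℝ} {b : Site 2} {Z : Type*}
    (hΩ₀ : Bornology.IsBounded Ω₀)
    (hflat : Ω₀ ∩ ball c ρ₀ = {z | 0 < ((z - c) * u).im} ∩ ball c ρ₀)
    (hδ : 0 < δ) (hδρ : 2 * δ ≤ ρ) (hM : 4 ≤ M) (hρρ₀ : 3 * ρ + δ < ρ₀)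
    (hbfar : M * ρ + δ ≤ dist (meshPoint δ b) c)
    (hgeom : ∀ K' : Set ℂ, K' ⊆ closedBall c (M * ρ) → b ∈ meshDomain (Ω₀ \ K') δ)
    (Φ : List (Site 2) → Z) (hRstar : M * ρ + δ ≤ Rstar)
    (hΦ : ∀ pfx l : List (Site 2), (∀ w ∈ pfx, dist (meshPoint δ w) c < Rstar) →
      (∃ h : l ≠ [], dist (meshPoint δ (l.head h)) c < Rstar) → Φ (pfx ++ l) = Φ l)
    (hη : 0 ≤ η) (hd : 0 ≤ d)
    (hS2 : ∀ (K K' : Set ℂ) (a a' : Site 2), K ⊆ closedBall c ρ → K' ⊆ closedBall c ρ →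
      dist (meshPoint δ a) c ≤ ρ → dist (meshPoint δ a') c ≤ ρ →
      (discreteDomainGraph (Ω₀ \ K) δ).Reachable a b → (discreteDomainGraph (Ω₀ \ K') δ).Reachable a' b →
      ENNReal.ofReal c₁ ≤ ∑' p : ℕ × Site 2 × Site 2,
        min (law (Ω₀ \ K) δ a b {γ | 2 * ρ + p.1 * δ ≤ 3 * ρ ∧ (∃ k : ℕ, (∀ i ≤ γ.walk.length,
            dist (meshPoint δ (γ.walk.getVert i)) c < 2 * ρ + p.1 * δ ↔ i ≤ k) ∧
            γ.walk.getVert k = p.2.1 ∧ γ.walk.getVert (k + 1) = p.2.2) ∧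
            ∀ j < p.1, ¬ ∃ k : ℕ, ∀ i ≤ γ.walk.length,
              dist (meshPoint δ (γ.walk.getVert i)) c < 2 * ρ + j * δ ↔ i ≤ k})
          (law (Ω₀ \ K') δ a' b {γ | 2 * ρ + p.1 * δ ≤ 3 * ρ ∧ (∃ k : ℕ, (∀ i ≤ γ.walk.length,
            dist (meshPoint δ (γ.walk.getVert i)) c < 2 * ρ + p.1 * δ ↔ i ≤ k) ∧
            γ.walk.getVert k = p.2.1 ∧ γ.walk.getVert (k + 1) = p.2.2) ∧
            ∀ j < p.1, ¬ ∃ k : ℕ, ∀ i ≤ γ.walk.length,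
              dist (meshPoint δ (γ.walk.getVert i)) c < 2 * ρ + j * δ ↔ i ≤ k}))
    (hS3 : ∀ (K : Set ℂ) (a : Site 2), K ⊆ closedBall c ρ → dist (meshPoint δ a) c ≤ ρ →
      (discreteDomainGraph (Ω₀ \ K) δ).Reachable a b →
      law (Ω₀ \ K) δ a b {γ | ∃ i i' : ℕ, i < i' ∧ i' ≤ γ.walk.length ∧
        M * ρ ≤ dist (meshPoint δ (γ.walk.getVert i)) c ∧
        dist (meshPoint δ (γ.walk.getVert i')) c < 3 * ρ} ≤ ENNReal.ofReal η)
    (hclose : ∀ (K K' : Set ℂ) (a a' : Site 2), K ⊆ closedBall c ((M + 1) * ρ) →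
      K' ⊆ closedBall c ((M + 1) * ρ) → dist (meshPoint δ a) c ≤ (M + 1) * ρ →
      dist (meshPoint δ a') c ≤ (M + 1) * ρ →
      (discreteDomainGraph (Ω₀ \ K) δ).Reachable a b → (discreteDomainGraph (Ω₀ \ K') δ).Reachable a' b →
      ∀ A : Set Z, (law (Ω₀ \ K) δ a b {γ | Φ γ.walk.support ∈ A}).toReal ≤
        (law (Ω₀ \ K') δ a' b {γ | Φ γ.walk.support ∈ A}).toReal + d)
    (K K' : Set ℂ) (a a' : Site 2) (hK : K ⊆ closedBall c ρ) (hK' : K' ⊆ closedBall c ρ)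
    (ha : dist (meshPoint δ a) c ≤ ρ) (ha' : dist (meshPoint δ a') c ≤ ρ)
    (hr : (discreteDomainGraph (Ω₀ \ K) δ).Reachable a b)
    (hr' : (discreteDomainGraph (Ω₀ \ K') δ).Reachable a' b) (A : Set Z) :
    (law (Ω₀ \ K) δ a b {γ | Φ γ.walk.support ∈ A}).toReal ≤
      (law (Ω₀ \ K') δ a' b {γ | Φ γ.walk.support ∈ A}).toReal + (4 * η + (1 - c₁ + 4 * η) * d) := by
  classical
  -- numerics
  have hρ : 0 < ρ := by linarith
  have hδρ' : δ ≤ ρ := by linarith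
  have hρM : ρ < M * ρ := by nlinarith
  have h3M : 3 * ρ < M * ρ := by nlinarith
  have h3far : 3 * ρ + δ ≤ dist (meshPoint δ b) c := by nlinarith
  have haM : dist (meshPoint δ a) c < M * ρ := by linarith
  have haM' : dist (meshPoint δ a') c < M * ρ := by linarith
  have hbM : M * ρ ≤ dist (meshPoint δ b) c := by linarith
  have hb : b ∈ meshDomain (Ω₀ \ K) δ := hgeom K (hK.trans (closedBall_subset_closedBall hρM.le))
  have hb' : b ∈ meshDomain (Ω₀ \ K') δ := hgeom K' (hK'.trans (closedBall_subset_closedBall hρM.le))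
  have hbs : ∀ j : ℕ, 2 * ρ + j * δ ≤ 3 * ρ →
      b ∈ meshDomain (Ω₀ \ (ball c (2 * ρ + j * δ) \ {z | ∃ x' y' : Site 2, (zdGraph 2).Adj x' y' ∧
        2 * ρ + j * δ ≤ dist (meshPoint δ x') c ∧ 2 * ρ + j * δ ≤ dist (meshPoint δ y') c ∧
        z ∈ segment ℝ (meshPoint δ x') (meshPoint δ y')})) δ := fun j hj =>
    hgeom _ (Set.sdiff_subset.trans (ball_subset_closedBall.trans
      (closedBall_subset_closedBall (by linarith))))
  -- the two finite probability spaces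
  haveI := TPToTraversalBound.Radial.finite_domainSAW (hΩ₀.subset Set.sdiff_subset) hδ a b (Ω := Ω₀ \ K)
  haveI := TPToTraversalBound.Radial.finite_domainSAW (hΩ₀.subset Set.sdiff_subset) hδ a' b (Ω := Ω₀ \ K')
  haveI := Fintype.ofFinite (DomainSAW (Ω₀ \ K) δ a b)
  haveI := Fintype.ofFinite (DomainSAW (Ω₀ \ K') δ a' b)
  set p : DomainSAW (Ω₀ \ K) δ a b → ℝ := fun x => (law (Ω₀ \ K) δ a b {x}).toReal with hp
  set p' : DomainSAW (Ω₀ \ K') δ a' b → ℝ := fun x => (law (Ω₀ \ K') δ a' b {x}).toReal with hp'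
  have hp0 : ∀ x, 0 ≤ p x := fun x => ENNReal.toReal_nonneg
  have hp0' : ∀ x, 0 ≤ p' x := fun x => ENNReal.toReal_nonneg
  have hp1 : ∑ x, p x = 1 := by
    rw [hp, sum_toReal_law_singleton, law_univ_eq_one_of_reachable (hΩ₀.subset Set.sdiff_subset) hδ hr]
    rfl
  have hp1' : ∑ x, p' x = 1 := by
    rw [hp', sum_toReal_law_singleton, law_univ_eq_one_of_reachable (hΩ₀.subset Set.sdiff_subset) hδ hr']
    rfl
  -- screens, proxies, deep returns
  set s : DomainSAW (Ω₀ \ K) δ a b → Option (ℕ × Site 2 × Site 2) := fun x =>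
    if h : ∃ w : ℕ × Site 2 × Site 2, ScrEv[δ, c, ρ](w.1, w.2.1, w.2.2 ; x.walk.support)
      then some (Classical.choose h) else none with hs
  set s' : DomainSAW (Ω₀ \ K') δ a' b → Option (ℕ × Site 2 × Site 2) := fun x =>
    if h : ∃ w : ℕ × Site 2 × Site 2, ScrEv[δ, c, ρ](w.1, w.2.1, w.2.2 ; x.walk.support)
      then some (Classical.choose h) else none with hs'
  set pfx : List (Site 2) → List (Site 2) := fun l =>
    l.take (l.findIdx (fun w => decide (M * ρ ≤ dist (meshPoint δ w) c)) + 1) with hpfx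
  set scr : List (Site 2) → Option (ℕ × Site 2 × Site 2) := fun l =>
    if h : ∃ w : ℕ × Site 2 × Site 2, ScrEv[δ, c, ρ](w.1, w.2.1, w.2.2 ; l)
      then some (Classical.choose h) else none with hscr
  set sc : DomainSAW (Ω₀ \ K) δ a b → Option (ℕ × Site 2 × Site 2) := fun x => scr (pfx x.walk.support)
    with hsc
  set sc' : DomainSAW (Ω₀ \ K') δ a' b → Option (ℕ × Site 2 × Site 2) := fun x => scr (pfx x.walk.support)
    with hsc'
  have hsv : ∀ (x : DomainSAW (Ω₀ \ K) δ a b) v, s x = some v ↔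
      ScrEv[δ, c, ρ](v.1, v.2.1, v.2.2 ; x.walk.support) := fun x v =>
    screenOf_eq_some_iff (ρ := ρ) x.walk.support v
  have hsv' : ∀ (x : DomainSAW (Ω₀ \ K') δ a' b) v, s' x = some v ↔
      ScrEv[δ, c, ρ](v.1, v.2.1, v.2.2 ; x.walk.support) := fun x v =>
    screenOf_eq_some_iff (ρ := ρ) x.walk.support v
  have hscrv : ∀ l v, scr l = some v ↔ ScrEv[δ, c, ρ](v.1, v.2.1, v.2.2 ; l) := fun l v =>
    screenOf_eq_some_iff (ρ := ρ) l v
  set R : DomainSAW (Ω₀ \ K) δ a b → Prop := fun γ => ∃ i i' : ℕ, i < i' ∧ i' ≤ γ.walk.length ∧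
    M * ρ ≤ dist (meshPoint δ (γ.walk.getVert i)) c ∧ dist (meshPoint δ (γ.walk.getVert i')) c < 3 * ρ
    with hR
  set R' : DomainSAW (Ω₀ \ K') δ a' b → Prop := fun γ => ∃ i i' : ℕ, i < i' ∧ i' ≤ γ.walk.length ∧
    M * ρ ≤ dist (meshPoint δ (γ.walk.getVert i)) c ∧ dist (meshPoint δ (γ.walk.getVert i')) c < 3 * ρ
    with hR'
  -- proxy = true screen off deep returns (for walks of either space)
  have hproxy : ∀ {Ω : Set ℂ} {a₀ : Site 2} (γ : DomainSAW Ω δ a₀ b), dist (meshPoint δ a₀) c < M * ρ →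
      (¬ ∃ i i' : ℕ, i < i' ∧ i' ≤ γ.walk.length ∧ M * ρ ≤ dist (meshPoint δ (γ.walk.getVert i)) c ∧
        dist (meshPoint δ (γ.walk.getVert i')) c < 3 * ρ) →
      scr (pfx γ.walk.support) = scr γ.walk.support := by
    intro Ω a₀ γ ha₀ hnR
    have hne : γ.walk.support ≠ [] := SimpleGraph.Walk.support_ne_nil _
    obtain ⟨-, ⟨hτ, hτout⟩, -⟩ := firstExit_spec (r := M * ρ) γ.walk.support hne
      (by rw [SimpleGraph.Walk.head_support]; exact ha₀)
      (by rw [SimpleGraph.Walk.getLast_support]; exact hbM)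
    generalize hτeq : (γ.walk.support.findIdx fun w => decide (M * ρ ≤ dist (meshPoint δ w) c)) = τ
      at hτ hτout
    have hndr : ∀ i' : ℕ, (hi' : i' < γ.walk.support.length) → τ < i' →
        3 * ρ ≤ dist (meshPoint δ (γ.walk.support[i'])) c := by
      intro i' hi' hτi'
      by_contra hlt
      push Not at hlt
      exact hnR ((deepReturn_walk_iff γ.walk (M * ρ) (3 * ρ)).2 ⟨τ, i', hτ, hi', hτi', hτout, hlt⟩)
    refine Option.eq_of_forall_eq_some_iff fun v => ?_
    rw [hscrv, hscrv]
    show ScrEv[δ, c, ρ](v.1, v.2.1, v.2.2 ; pfx γ.walk.support) ↔ _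
    simp only [hpfx, hτeq]
    exact (screen_take_iff hδ.le h3M γ.walk.support hτ hτout hndr v.1 v.2.1 v.2.2).symm
  -- the finite set of screen values
  set V : Finset (ℕ × Site 2 × Site 2) :=
    ((Finset.univ.image sc ∪ Finset.univ.image s) ∪ (Finset.univ.image sc' ∪ Finset.univ.image s')).eraseNone
    with hV
  have hVmem : ∀ v, (∃ x, sc x = some v) ∨ (∃ x, s x = some v) ∨ (∃ x, sc' x = some v) ∨ (∃ x, s' x = some v) →
      v ∈ V := by
    intro v hv
    rw [hV, Finset.mem_eraseNone]
    simp only [Finset.mem_union, Finset.mem_image, Finset.mem_univ, true_and]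
    rcases hv with h | h | h | h
    · exact Or.inl (Or.inl h)
    · exact Or.inl (Or.inr h)
    · exact Or.inr (Or.inl h)
    · exact Or.inr (Or.inr h)
  -- kernels
  set q : ℕ × Site 2 × Site 2 → Set Z → ℝ := fun v A' =>
    (law (Ω₀ \ (ball c (2 * ρ + v.1 * δ) \ {z | ∃ x' y' : Site 2, (zdGraph 2).Adj x' y' ∧
        2 * ρ + v.1 * δ ≤ dist (meshPoint δ x') c ∧ 2 * ρ + v.1 * δ ≤ dist (meshPoint δ y') c ∧
        z ∈ segment ℝ (meshPoint δ x') (meshPoint δ y')})) δ v.2.2 b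
      {β | Φ β.walk.support ∈ A'}).toReal with hq
  set μ : DomainSAW (Ω₀ \ K) δ a b → Set Z → ℝ := fun x A' =>
    (law (Ω₀ \ (K ∪ meshPoint δ '' {w | w ∈ x.walk.support.take (x.walk.support.findIdx
        (fun w => decide (M * ρ ≤ dist (meshPoint δ w) c)))}))
      δ (x.walk.getVert (x.walk.support.findIdx (fun w => decide (M * ρ ≤ dist (meshPoint δ w) c)))) b
      {β | Φ β.walk.support ∈ A'}).toReal with hμ
  set ν : DomainSAW (Ω₀ \ K') δ a' b → Set Z → ℝ := fun x A' =>
    (law (Ω₀ \ (K' ∪ meshPoint δ '' {w | w ∈ x.walk.support.take (x.walk.support.findIdx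
        (fun w => decide (M * ρ ≤ dist (meshPoint δ w) c)))}))
      δ (x.walk.getVert (x.walk.support.findIdx (fun w => decide (M * ρ ≤ dist (meshPoint δ w) c)))) b
      {β | Φ β.walk.support ∈ A'}).toReal with hν
  have hlawle1 : ∀ {Ω : Set ℂ} {a₀ : Site 2} (S : Set (DomainSAW Ω δ a₀ b)), (law Ω δ a₀ b S).toReal ≤ 1 :=
    fun S => by
      have := ENNReal.toReal_mono ENNReal.one_ne_top (law_apply_le_one S)
      simpa using this
  -- class `(M+1)ρ` of the conditioned configurations
  have hcond : ∀ {K₀ : Set ℂ} {a₀ : Site 2}, K₀ ⊆ closedBall c ρ → dist (meshPoint δ a₀) c ≤ ρ →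
      ∀ x : DomainSAW (Ω₀ \ K₀) δ a₀ b,
      (K₀ ∪ meshPoint δ '' {w | w ∈ x.walk.support.take (x.walk.support.findIdx
          (fun w => decide (M * ρ ≤ dist (meshPoint δ w) c)))}) ⊆ closedBall c ((M + 1) * ρ) ∧
      dist (meshPoint δ (x.walk.getVert (x.walk.support.findIdx
          (fun w => decide (M * ρ ≤ dist (meshPoint δ w) c))))) c ≤ (M + 1) * ρ ∧
      (discreteDomainGraph (Ω₀ \ (K₀ ∪ meshPoint δ '' {w | w ∈ x.walk.support.take
          (x.walk.support.findIdx (fun w => decide (M * ρ ≤ dist (meshPoint δ w) c)))})) δ).Reachable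
        (x.walk.getVert (x.walk.support.findIdx (fun w => decide (M * ρ ≤ dist (meshPoint δ w) c)))) b := by
    intro K₀ a₀ hK₀ ha₀ x
    obtain ⟨hpos, ⟨hτ, hout, hlt⟩, hin⟩ := exit_spec (R := M * ρ) hδ (lt_of_le_of_lt ha₀ hρM) hbM x
    generalize hτeq : (x.walk.support.findIdx fun w => decide (M * ρ ≤ dist (meshPoint δ w) c)) = τ
      at hpos hτ hout hlt hin ⊢
    have hv : x.walk.getVert τ = x.walk.support[τ] := getVert_eq_getElem_support _ hτ
    refine ⟨?_, ?_, ?_⟩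
    · rintro z (hz | ⟨w, hw, rfl⟩)
      · exact closedBall_subset_closedBall (by nlinarith) (hK₀ hz)
      · exact mem_closedBall.2 (by have := hin w hw; nlinarith)
    · rw [hv]; nlinarith
    · -- the suffix of `x` itself joins the exit vertex to `b` in the conditioned domain
      set α : (discreteDomainGraph (Ω₀ \ K₀) δ).Walk a₀ (x.walk.getVert τ) := x.walk.take τ with hα
      have hαd : α.support.dropLast = x.walk.support.take τ := by
        rw [hα, SimpleGraph.Walk.support_take, List.dropLast_eq_take, List.take_take, List.length_take]
        congr 1
        omega
      have hK'form : K₀ ∪ meshPoint δ '' {w | w ∈ x.walk.support.take τ} =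
          K₀ ∪ meshPoint δ '' {w | w ∈ α.support.dropLast} := by rw [hαd]
      have hballK : K₀ ∪ meshPoint δ '' {w | w ∈ x.walk.support.take τ} ⊆ closedBall c (M * ρ) := by
        rintro z (hz | ⟨w, hw, rfl⟩)
        · exact closedBall_subset_closedBall hρM.le (hK₀ hz)
        · exact mem_closedBall.2 (hin w hw).le
      obtain ⟨β', -⟩ := markov_T2 hδ α hK'form (hgeom _ hballK) x
        (by rw [hα, SimpleGraph.Walk.support_take]; exact List.take_prefix _ _)
      exact β'.walk.reachable
  -- the abstract step
  have key := Abstract.abstract_step (X := DomainSAW (Ω₀ \ K) δ a b) (X' := DomainSAW (Ω₀ \ K') δ a' b)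
    p p' hp0 hp0' hp1 hp1' (fun x => Φ x.walk.support) (fun x => Φ x.walk.support) sc s sc' s' R R'
    (η := η) ?_ ?_ ?_ ?_ V ?_ ?_ q (fun v A' => ENNReal.toReal_nonneg) (fun v A' => hlawle1 _)
    ?_ ?_ μ ν ?_ ?_ hd ?_ (c₁ := c₁) ?_ A
  · -- conclusion
    have e1 : (∑ x, p x * (if Φ x.walk.support ∈ A then (1:ℝ) else 0)) =
        (law (Ω₀ \ K) δ a b {γ | Φ γ.walk.support ∈ A}).toReal := by
      rw [toReal_law_eq_sum]; rfl
    have e2 : (∑ x, p' x * (if Φ x.walk.support ∈ A then (1:ℝ) else 0)) =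
        (law (Ω₀ \ K') δ a' b {γ | Φ γ.walk.support ∈ A}).toReal := by
      rw [toReal_law_eq_sum]; rfl
    rw [e1, e2] at key
    linarith [(abs_sub_le_iff.1 key).1]
  · -- mass of the deep returns (S3)
    have e : ∑ x ∈ Finset.univ.filter R, p x = (law (Ω₀ \ K) δ a b {x | R x}).toReal := by
      rw [toReal_law_setOf_eq_sum_filter]
    rw [e]
    exact ENNReal.toReal_le_of_le_ofReal hη (hS3 K a hK ha hr)
  · have e : ∑ x ∈ Finset.univ.filter R', p' x = (law (Ω₀ \ K') δ a' b {x | R' x}).toReal := by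
      rw [toReal_law_setOf_eq_sum_filter]
    rw [e]
    exact ENNReal.toReal_le_of_le_ofReal hη (hS3 K' a' hK' ha' hr')
  · intro x hx; exact hproxy x haM hx
  · intro x hx; exact hproxy x haM' hx
  · intro x v hv; exact hVmem v (Or.inl ⟨x, hv⟩)
  · intro x v hv; exact hVmem v (Or.inr (Or.inr (Or.inl ⟨x, hv⟩)))
  · intro g A' _ hg
    exact screen_identity (c := c) hΩ₀ hflat hδ hδρ hρρ₀ hK ha h3far hb hbs Φ (by linarith) hΦ s hsv g hg A'
  · intro g A' _ hg
    exact screen_identity (c := c) hΩ₀ hflat hδ hδρ hρρ₀ hK' ha' h3far hb' hbs Φ (by linarith) hΦ s' hsv' g hg A'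
  · intro g A' _
    exact markov_identity (c := c) hΩ₀ hδ hK ha hρM hbfar hb hgeom Φ hRstar hΦ (fun l => g (scr l)) A'
  · intro g A' _
    exact markov_identity (c := c) hΩ₀ hδ hK' ha' hρM hbfar hb' hgeom Φ hRstar hΦ (fun l => g (scr l)) A'
  · -- the Markov kernels are class-`(M+1)ρ` laws, pairwise `d`-close
    intro x x' A' _ _
    obtain ⟨h1, h2, h3⟩ := hcond hK ha x
    obtain ⟨h1', h2', h3'⟩ := hcond hK' ha' x'
    have := hclose _ _ _ _ h1 h1' h2 h2' h3 h3' A'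
    have := hclose _ _ _ _ h1' h1 h2' h2 h3' h3 A'
    rw [abs_sub_le_iff]
    constructor <;> linarith
  · -- overlap of the true screens (S2)
    have hS := hS2 K K' a a' hK hK' ha ha' hr hr'
    -- the route events are the fibres of `s`, `s'`
    have hE : ∀ pp : ℕ × Site 2 × Site 2,
        {γ : DomainSAW (Ω₀ \ K) δ a b | 2 * ρ + pp.1 * δ ≤ 3 * ρ ∧ (∃ k : ℕ, (∀ i ≤ γ.walk.length,
            dist (meshPoint δ (γ.walk.getVert i)) c < 2 * ρ + pp.1 * δ ↔ i ≤ k) ∧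
            γ.walk.getVert k = pp.2.1 ∧ γ.walk.getVert (k + 1) = pp.2.2) ∧
            ∀ j < pp.1, ¬ ∃ k : ℕ, ∀ i ≤ γ.walk.length,
              dist (meshPoint δ (γ.walk.getVert i)) c < 2 * ρ + j * δ ↔ i ≤ k} = {γ | s γ = some pp} := by
      intro pp; ext γ; rw [mem_setOf_eq, mem_setOf_eq, hsv, routeScreen_iff h3far hδ.le]
    have hE' : ∀ pp : ℕ × Site 2 × Site 2,
        {γ : DomainSAW (Ω₀ \ K') δ a' b | 2 * ρ + pp.1 * δ ≤ 3 * ρ ∧ (∃ k : ℕ, (∀ i ≤ γ.walk.length,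
            dist (meshPoint δ (γ.walk.getVert i)) c < 2 * ρ + pp.1 * δ ↔ i ≤ k) ∧
            γ.walk.getVert k = pp.2.1 ∧ γ.walk.getVert (k + 1) = pp.2.2) ∧
            ∀ j < pp.1, ¬ ∃ k : ℕ, ∀ i ≤ γ.walk.length,
              dist (meshPoint δ (γ.walk.getVert i)) c < 2 * ρ + j * δ ↔ i ≤ k} = {γ | s' γ = some pp} := by
      intro pp; ext γ; rw [mem_setOf_eq, mem_setOf_eq, hsv', routeScreen_iff h3far hδ.le]
    simp only [hE, hE'] at hS
    -- truncate the series to `V`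
    rw [tsum_eq_sum (s := V)] at hS
    · have hfin : ∑ pp ∈ V, min (law (Ω₀ \ K) δ a b {γ | s γ = some pp})
          (law (Ω₀ \ K') δ a' b {γ | s' γ = some pp}) ≠ ⊤ :=
        ENNReal.sum_ne_top.2 fun pp _ => ne_top_of_le_ne_top (law_apply_ne_top _) (min_le_left _ _)
      by_cases hc₁ : c₁ ≤ 0
      · exact hc₁.trans (Finset.sum_nonneg fun v _ => le_min (Finset.sum_nonneg fun x _ => hp0 x)
          (Finset.sum_nonneg fun x _ => hp0' x))
      · push Not at hc₁
        have h1 := (ENNReal.ofReal_le_iff_le_toReal hfin).1 hS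
        rw [ENNReal.toReal_sum (fun pp _ => ne_top_of_le_ne_top (law_apply_ne_top _) (min_le_left _ _))] at h1
        refine h1.trans (le_of_eq (Finset.sum_congr rfl fun pp _ => ?_))
        rw [ENNReal.toReal_min (law_apply_ne_top _) (law_apply_ne_top _)]
        congr 1
        · have := toReal_law_inter_eq_sum_filter s (some pp) (univ : Set (DomainSAW (Ω₀ \ K) δ a b))
          rw [Set.inter_univ] at this
          rw [this]
          exact Finset.sum_congr rfl fun x _ => by simp [hp]
        · have := toReal_law_inter_eq_sum_filter s' (some pp) (univ : Set (DomainSAW (Ω₀ \ K') δ a' b))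
          rw [Set.inter_univ] at this
          rw [this]
          exact Finset.sum_congr rfl fun x _ => by simp [hp']
    · intro pp hpp
      have h1 : {γ : DomainSAW (Ω₀ \ K) δ a b | s γ = some pp} = ∅ := by
        ext γ
        simp only [mem_setOf_eq, mem_empty_iff_false, iff_false]
        exact fun h => hpp (hVmem pp (Or.inr (Or.inl ⟨γ, h⟩)))
      have h2 : {γ : DomainSAW (Ω₀ \ K') δ a' b | s' γ = some pp} = ∅ := by
        ext γ
        simp only [mem_setOf_eq, mem_empty_iff_false, iff_false]
        exact fun h => hpp (hVmem pp (Or.inr (Or.inr (Or.inr ⟨γ, h⟩))))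
      rw [h1, h2, measure_empty, measure_empty, min_self]

end OneStep

end Summit.CriticalPhenomena.SAWScalingLimit.Theorems.ScreeningRecursion

end
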